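import Summits.ResolutionOfSingularities.ResolutionOfSingularities.Theorems.PAlterationPialtAtomsOpenRange
import Literature.AlgebraicGeometry.Resolution.ProperModelsPatchingOfResolution
import Literature.AlgebraicGeometry.Resolution.ProperModelsJoin
import Literature.AlgebraicGeometry.Resolution.ResolutionOfCurves
import HarnessLib

/-!
# Stub `stub_twoModelPatchingAt_of_trdeg_le_one` (crux stmt-ResolutionOfSingularities-0552, line `Sketch` rev. c7)

Certification stub of the skeleton `Sketch` (rev. c7) for the crux `PalterationThesis`
(stmt-ResolutionOfSingularities-0552): the second perfect-field residue `TMP_K` — Piltant's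
two-model patching of proper models of a function field `F/K` (any two proper models are
dominated by a third that is `RegLe` over both) — is a theorem in transcendence degree `≤ 1`
over EVERY field `K`, unconditionally (resolution of curves). Twin of
`stub_regModelAt_of_trdeg_le_one` (lead c6) for the first residue `RegModel_K`.

Proof: the join `M₁ ⋈ M₂` (`ProperModel.join`, the closure of the diagonal `F`-point in
`M₁ ×_K M₂`) is a proper model of `F/K`, so `dim (M₁ ⋈ M₂).X = trdeg_K F = d ≤ 1`
(`properModel_topologicalKrullDim_eq_of_trdeg`); reduced curves over a field have resolutions
(`hasResolution_of_dim_le_one`, `ResolutionOfCurves.lean`); a resolution of a proper model is a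
REGULAR proper model dominating it (`ProperModel.exists_hom_isRegular_of_hasResolution`); compose
with the two projections of the join; a regular model is `RegLe` over every model it dominates.

## References

* O. Zariski, P. Samuel, *Commutative Algebra* II (1960), Ch. VI §17 (joins of models). [ZariskiSamuel1960]
* R. Hartshorne, *Algebraic Geometry* (1977), Ch. V Rem. 3.8.1 (curves). [Hartshorne1977]
-/

set_option linter.dupNamespace false

noncomputable section

open CategoryTheory AlgebraicGeometry
open Literature.AlgebraicGeometry.Resolution
open Summit.ResolutionOfSingularities.ResolutionOfSingularities.Theorems.Pialt.OpenRange
  (properModel_topologicalKrullDim_eq_of_trdeg)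

namespace Summit.ResolutionOfSingularities.ResolutionOfSingularities.Theorems.PalterationThesis.ZariskiPerfect

/-- CERTIFICATION STUB (worker-sized, rev. c7): the residue `TMP_K` — two-model patching of
proper models — in transcendence degree `≤ 1` over EVERY field `K`, unconditionally: the join
`M₁ ⋈ M₂` (`ProperModel.join`) is a proper model of dimension `trdeg_K F ≤ 1`
(`properModel_topologicalKrullDim_eq_of_trdeg`), reduced curves over a field have resolutions
(`hasResolution_of_dim_le_one`), a resolution of a proper model is a regular proper model
dominating it (`ProperModel.exists_hom_isRegular_of_hasResolution`), and a regular model is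
`RegLe` over every model it dominates. [folklore] -/
theorem stub_twoModelPatchingAt_of_trdeg_le_one (K : Type) [Field K] (F : Type) [Field F]
    [Algebra K F] [Algebra.EssFiniteType K F] (d : ℕ) (hd : d ≤ 1) (htr : Algebra.trdeg K F = d)
    (M₁ M₂ : ProperModel K F) :
    ∃ (N : ProperModel K F) (φ₁ : N.Hom M₁) (φ₂ : N.Hom M₂), φ₁.RegLe ∧ φ₂.RegLe := by
  -- the join is a proper model, of dimension `trdeg_K F = d ≤ 1`
  have hdim : topologicalKrullDim (ProperModel.join M₁ M₂).X ≤ 1 := by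
    rw [properModel_topologicalKrullDim_eq_of_trdeg (ProperModel.join M₁ M₂) htr]
    exact_mod_cast hd
  -- curves have resolutions; a resolution of a proper model is a regular proper model over it
  obtain ⟨N, φ, hN⟩ := ProperModel.exists_hom_isRegular_of_hasResolution (ProperModel.join M₁ M₂)
    (hasResolution_of_dim_le_one (ProperModel.join M₁ M₂).X (ProperModel.join M₁ M₂).π hdim)
  -- a regular model is `RegLe` over both models it dominates
  exact ⟨N, φ.comp (ProperModel.joinFst M₁ M₂), φ.comp (ProperModel.joinSnd M₁ M₂),
    fun y _ => hN y, fun y _ => hN y⟩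

end Summit.ResolutionOfSingularities.ResolutionOfSingularities.Theorems.PalterationThesis.ZariskiPerfect

end
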